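import Summits.Ventures.QEC.CircuitDistance.ETowerBridge
import Summits.Ventures.QEC.CircuitDistance.PortK2Complete
import HarnessLib

/-!
# P3-PORT STEP 2 (E-fold tower): S7 — FROM THE TOWER'S KERNEL COMPLETENESS TO THE K2 BINDER SHAPE
# (CARD-7 §5 S7, PORT-SPEC S7; cell `qec`, experiment CDX, seat qec-cdx-type-1)

`binder_of_kc` has the conclusion and the class-word hypotheses of `K2Inst.k2_completeG` (the route of record through the
cube runs) but takes, instead of the cube facts, (i) the tower's KERNEL COMPLETENESS `KC`: every numeral word `u < 2^N` in the
kernel of the syndrome table of record with weight `≤ W` satisfies `QTop` (all logical parities vanish, or a translate is a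
listed anchored class `TOPS`); (ii) `hTOPS`: each entry of `TOPS` is, as a set of class supports, a translate of a listed word
(decide, per sector); (iii) `hidx`: index translation = support translation (`G (transIdx da db n) = trQ (da, db) (G n)`,
from the two generator identities by `idxTr_all_of_gens`, decide per sector).  So `K2_BB144_X/Z` follow from the tower exactly
where `k2_bb144_X/Z` used the cubes.  Generic in the instance; no data; no `native_decide`.
-/

namespace Summit.Ventures.QEC.CircuitDistance.ETower

open Literature.InformationTheory.QuantumCodes Summit.Ventures.QEC.Census Summit.Ventures.QEC.Census.Fold Finset K2

variable {ℓ m : ℕ} [NeZero ℓ] [NeZero m]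

/-! ## Index translation versus support translation -/

/-- From the two generator identities to all translations. -/
theorem idxTr_all_of_gens (hl : 0 < ℓ) (hm : 0 < m) {nb : ℕ} (G : ℕ → Finset (BB.Mono ℓ m ⊕ BB.Mono ℓ m))
    (hx : ∀ n, n < nb * (ℓ * m) → G (transIdx ℓ m 1 0 n) = trQ (Fin.ofNat ℓ 1, Fin.ofNat m 0) (G n))
    (hy : ∀ n, n < nb * (ℓ * m) → G (transIdx ℓ m 0 1 n) = trQ (Fin.ofNat ℓ 0, Fin.ofNat m 1) (G n)) :
    ∀ da db n, n < nb * (ℓ * m) → G (transIdx ℓ m da db n) = trQ (Fin.ofNat ℓ da, Fin.ofNat m db) (G n) := by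
  have pair_add : ∀ a b c d : ℕ, ((Fin.ofNat ℓ a, Fin.ofNat m b) : BB.Mono ℓ m) + (Fin.ofNat ℓ c, Fin.ofNat m d) =
      (Fin.ofNat ℓ (a + c), Fin.ofNat m (b + d)) := by
    intro a b c d
    ext <;> simp [Fin.val_add, Fin.ofNat, Nat.add_mod]
  have pair_zero : ((Fin.ofNat ℓ 0, Fin.ofNat m 0) : BB.Mono ℓ m) = 0 := by
    ext <;> simp [Fin.ofNat]
  intro da
  induction da with
  | zero =>
    intro db
    induction db with
    | zero =>
      intro n _
      rw [transIdx_zeroK hl hm, pair_zero, K2Inst.trQ_zero']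
    | succ db ih =>
      intro n hn
      rw [show (0 : ℕ) = 0 + 0 from rfl, show db + 1 = 1 + db from Nat.add_comm _ _, ← transIdx_comp hl hm,
        hy _ (transIdx_ltK hl hm nb 0 db hn), ih n hn, ← trQ_add, pair_add, Nat.add_comm db 1]
  | succ da ih =>
    intro db n hn
    rw [show da + 1 = 1 + da from Nat.add_comm _ _, show db = 0 + db from (Nat.zero_add _).symm, ← transIdx_comp hl hm,
      hx _ (transIdx_ltK hl hm nb da db hn), ih db n hn, ← trQ_add, pair_add, Nat.add_comm da 1, Nat.add_zero, Nat.zero_add]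

/-- The Bool form of the generator identities. -/
def idxTrCheck (nb : ℕ) (G : ℕ → Finset (BB.Mono ℓ m ⊕ BB.Mono ℓ m)) : Bool :=
  (List.range (nb * (ℓ * m))).all fun n =>
    decide (G (transIdx ℓ m 1 0 n) = trQ (Fin.ofNat ℓ 1, Fin.ofNat m 0) (G n)) &&
    decide (G (transIdx ℓ m 0 1 n) = trQ (Fin.ofNat ℓ 0, Fin.ofNat m 1) (G n))

/-- `idxTrCheck` decides the generator identities. -/
theorem idxTr_of_check {nb : ℕ} {G : ℕ → Finset (BB.Mono ℓ m ⊕ BB.Mono ℓ m)} (h : idxTrCheck nb G = true) :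
    (∀ n, n < nb * (ℓ * m) → G (transIdx ℓ m 1 0 n) = trQ (Fin.ofNat ℓ 1, Fin.ofNat m 0) (G n)) ∧
    (∀ n, n < nb * (ℓ * m) → G (transIdx ℓ m 0 1 n) = trQ (Fin.ofNat ℓ 0, Fin.ofNat m 1) (G n)) := by
  unfold idxTrCheck at h
  rw [List.all_eq_true] at h
  refine ⟨fun n hn => ?_, fun n hn => ?_⟩
  · have := h n (List.mem_range.2 hn); rw [Bool.and_eq_true, decide_eq_true_eq, decide_eq_true_eq] at this; exact this.1
  · have := h n (List.mem_range.2 hn); rw [Bool.and_eq_true, decide_eq_true_eq, decide_eq_true_eq] at this; exact this.2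

/-! ## The binder from kernel completeness -/

/-- **S7: THE K2 BINDER SHAPE FROM THE TOWER.**  Same class-word hypotheses and conclusion as `K2Inst.k2_completeG`; the cube
facts are replaced by the tower's kernel completeness `hKC` plus the two decide-sized data facts `hTOPS`, `hidx`. -/
theorem binder_of_kc {I : K2Inst ℓ m} {H : BB.Mono ℓ m → (BB.Mono ℓ m ⊕ BB.Mono ℓ m) → ZMod 2}
    {words : List (List (Finset (BB.Mono ℓ m ⊕ BB.Mono ℓ m)))} (hg : I.Good H words)
    {Hs : Matrix (BB.Mono ℓ m) (BB.Mono ℓ m ⊕ BB.Mono ℓ m) (ZMod 2)}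
    (hlog : ∀ v, Matrix.mulVec H v = 0 → v ∉ rowSpace Hs → ∃ s ∈ I.lsupp, indic s ⬝ᵥ v ≠ 0)
    (hl : 0 < ℓ) (hm : 0 < m) {nb W : ℕ} (hN : I.D.N = nb * (ℓ * m)) {TOPS : List ℕ}
    (hKC : ∀ u, u < 2 ^ (nb * (ℓ * m)) → kerK I.D.synOf (nb * (ℓ * m)) u → popc (nb * (ℓ * m)) u ≤ W →
      QTop ℓ m nb I.D.synOf I.D.lgOf TOPS u)
    (hTOPS : ∀ r ∈ TOPS, ∃ wd ∈ words, ∃ t : BB.Mono ℓ m,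
      ((bitsOf (nb * (ℓ * m)) 0 r).map I.G).toFinset = (wd.map (trQ t)).toFinset)
    (hidx : ∀ da db n, n < nb * (ℓ * m) → I.G (transIdx ℓ m da db n) = trQ (Fin.ofNat ℓ da, Fin.ofNat m db) (I.G n))
    (x : Finset (Finset (BB.Mono ℓ m ⊕ BB.Mono ℓ m))) (hx : ∀ g ∈ x, g ∈ I.gsupp)
    (hz : Matrix.mulVec H (∑ g ∈ x, indic g) = 0) (hn : (∑ g ∈ x, indic g) ∉ rowSpace Hs) (hcard : x.card ≤ W) :
    ∃ wd ∈ words, ∃ t : BB.Mono ℓ m, x = (wd.map (trQ t)).toFinset := by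
  set N := nb * (ℓ * m) with hNdef
  set ix := I.ixOf x with hixdef
  have hix : ∀ n ∈ ix, n < N := fun n hn' => by rw [← hN]; exact (K2Inst.mem_ixOf.1 hn').1
  have hix' : ∀ n ∈ ix, n < I.D.N := fun n hn' => (K2Inst.mem_ixOf.1 hn').1
  set u := maskF ix with hudef
  have hult : u < 2 ^ N := maskF_lt hix
  have hvec : I.vecOf ix = ∑ g ∈ x, indic g := K2Inst.vecOf_ixOf hg hx
  -- kernel word
  have hker : kerK I.D.synOf N u := by
    rw [hudef, kerK_synOf_iff_zeroSyn I.D hix, K2Inst.zeroSyn_iff hg hix', hvec]; exact hz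
  -- weight
  have hwt : popc N u ≤ W := by rw [hudef, popc_maskF hix, hixdef, K2Inst.card_ixOf hg hx]; exact hcard
  rcases hKC u hult hker hwt with hlg | ⟨r, hr, da, db, htr⟩
  · -- all logical parities even: the vector would be a stabiliser
    exfalso
    have hl0 : ∀ j, I.D.lgBit ix j = false := (kerK_lgOf_iff I.D hix).1 (hlg hker)
    have hzs : I.D.ZeroSyn ix := (kerK_synOf_iff_zeroSyn I.D hix).1 hker
    have := K2Inst.mem_rowSpace_of_lgZero hg hlog hix' hzs hl0
    rw [hvec] at this; exact hn this
  · -- a translate of `u` is the listed anchored class `r`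
    obtain ⟨wd, hwd, t, hwt'⟩ := hTOPS r hr
    set t₀ : BB.Mono ℓ m := (Fin.ofNat ℓ da, Fin.ofNat m db) with ht₀
    -- the support of `r` is the translate of `ix`
    have hsupp : ∀ n', n' ∈ bitsOf N 0 r ↔ ∃ n ∈ ix, transIdx ℓ m da db n = n' := by
      intro n'
      rw [mem_bitsOf_zero_iff]
      constructor
      · rintro ⟨hn'N, hbit⟩
        -- pull back along the inverse translation
        set n := transIdx ℓ m (ℓ - da % ℓ) (m - db % m) n' with hndef
        have hnN : n < N := transIdx_ltK hl hm nb _ _ hn'N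
        have hcomp : transIdx ℓ m da db n = n' := by
          rw [hndef, ← transIdx_mod da db, transIdx_comp hl hm, Nat.add_sub_cancel' (Nat.mod_lt da hl).le,
            Nat.add_sub_cancel' (Nat.mod_lt db hm).le, ← transIdx_mod ℓ m n', Nat.mod_self, Nat.mod_self,
            transIdx_zeroK hl hm]
        refine ⟨n, ?_, hcomp⟩
        have hb := testBit_transWK hl hm nb da db u hnN
        rw [htr, hcomp, hbit] at hb
        have : u.testBit n = true := hb.symm
        rw [hudef, testBit_maskF, decide_eq_true_eq] at this
        exact this
      · rintro ⟨n, hnix, rfl⟩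
        refine ⟨transIdx_ltK hl hm nb da db (hix n hnix), ?_⟩
        rw [← htr, testBit_transWK hl hm nb da db u (hix n hnix), hudef, testBit_maskF, decide_eq_true_eq]
        exact hnix
    -- images under `G`
    have himg : ((bitsOf N 0 r).map I.G).toFinset = x.image (trQ t₀) := by
      ext g
      rw [List.mem_toFinset, List.mem_map, Finset.mem_image]
      constructor
      · rintro ⟨n', hn', rfl⟩
        obtain ⟨n, hnix, rfl⟩ := (hsupp n').1 hn'
        refine ⟨I.G n, (K2Inst.mem_ixOf.1 hnix).2, ?_⟩
        rw [hidx da db n (hix n hnix)]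
      · rintro ⟨g', hg', rfl⟩
        obtain ⟨n, hnN, rfl⟩ := K2Inst.exists_idx hg (hx g' hg')
        have hnix : n ∈ ix := K2Inst.mem_ixOf.2 ⟨hnN, hg'⟩
        exact ⟨transIdx ℓ m da db n, (hsupp _).2 ⟨n, hnix, rfl⟩, hidx da db n (hix n hnix)⟩
    rw [himg] at hwt'
    -- undo the translation
    refine ⟨wd, hwd, t + -t₀, ?_⟩
    ext g
    rw [List.mem_toFinset, List.mem_map]
    constructor
    · intro hgx
      have h1 : trQ t₀ g ∈ (wd.map (trQ t)).toFinset := by rw [← hwt']; exact Finset.mem_image_of_mem _ hgx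
      rw [List.mem_toFinset, List.mem_map] at h1
      obtain ⟨w, hw, hwg⟩ := h1
      refine ⟨w, hw, ?_⟩
      rw [trQ_add, hwg, K2Inst.trQ_neg_trQ]
    · rintro ⟨w, hw, rfl⟩
      have h1 : trQ t w ∈ x.image (trQ t₀) := by rw [hwt', List.mem_toFinset, List.mem_map]; exact ⟨w, hw, rfl⟩
      obtain ⟨g', hg', hg'w⟩ := Finset.mem_image.1 h1
      rw [trQ_add, ← hg'w, K2Inst.trQ_neg_trQ]
      exact hg'

end Summit.Ventures.QEC.CircuitDistance.ETower
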